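import Summits.CriticalPhenomena.PercolationContinuityZ3.Theorems.PercNearOneGluingNoHeavyQuantHullHighCons
import HarnessLib

/-!
# QUANT lane R8, T-DEC: **THE NODE REDUCED TO ONE LAW-LEVEL STATEMENT, THE GLUED-PIECE SLICE** — a sibling whose sub-forest law splits into two-point
# pieces that are tame OR "glued with an on-floor block" is adjoinable to any SDEC forest, GIVEN the glued-piece slice (arm-1 gen 57, architect)

builds on p205010 (kernel theorem, internal audit signed; external expert review pending)

Support file (`--supports stmt-CriticalPhenomena-4575`), QUANT lane seat prim-quant-arm-1 (gen 57, architect); memo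
`run/shared/lean/prim/quant/prim-quant-arm-1-g57/ARCH-G57.md` §6–§7.  Theorems only (the conjecture enters as the explicit hypothesis `hGPS`, spelled out — no
definition, nothing claimed unconditionally); standard axioms, no sorries.

THE OBSERVATION.  The gate is affine: if the sub-forest law of a sibling `s` is a same-mean mixture `s.ρ = Σᵢ wᵢ·{loᵢ, loᵢ+Kᵢ; γᵢ}` then
`gate s.ρ s.q = Σᵢ wᵢ·gate {loᵢ,loᵢ+Kᵢ;γᵢ} s.q` and `flaw (s :: L) = Σᵢ wᵢ·flaw (sᵢ :: L)` for the PSEUDO-SIBLINGS `sᵢ = ⟨s.q, _, _, loᵢ+Kᵢ, {loᵢ,loᵢ+Kᵢ;γᵢ}⟩` = the glued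
siblings `R^{loᵢ}[q](R^{Kᵢ}[γᵢ])` (law `{0: 1−q, loᵢ: q(1−γᵢ), loᵢ+Kᵢ: qγᵢ}`), all of mean `fmean L + q·s.mean`; SDEC is convex along same-mean mixtures
(`sdec_of_gatedSDECMixture`).  A piece that is LIGHT (`Kγ ≤ lo`), a BLOB (`lo = 0`) or FLOORED is a TAME pseudo-sibling — adjoinable by `sdec_cons_of_tame`
(✓ `…QuantCompSlice`).  The remaining pieces are heavy, unfloored, `lo ≥ 1`, and the ONE statement owed for them is the
**GLUED-PIECE SLICE** (conjecture; `hGPS` below): `β` SDEC + affordable at `x`, `0 < q < 1`, `0 ≤ g ≤ 1`, `r, k ≥ 1`, the block ON the floor `x ≤ q·g`, affordable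
`x(r+k) ≤ q(r+kg)` ⟹ `SDEC x (B + (r+k)) (β ∗ gate {r,r+k;g} q)`.  EVIDENCE (memo §6–§7, kernel-faithful LP): 235/235 random + 392/392 adversarial (β at its
maximal SDEC floor, the MIX1-cex geometry); its per-layer form (G = gate_a β feasible at layers j, j−r, j−r−k ⟹ the glued law feasible at j) 2 097 + 2 176 / 0;
the regime `q·g < x` is FALSE (β = δ₁ witnesses), so the on-floor condition is sharp.  REACH: on the lane's sibling generators (chains, stars, brooms,
cherries, near-blobs, glued blocks, random depth-3 trees, M ≤ 8, near-sure heavy) EVERY sibling is tame, hull+high, or piecewise-OK in the sense below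
(499/499 + 254/254; memo §7) — so, given the glued-piece slice, no sampled forest is left for `SiblingStep`.

* `tpl_charged` (the charged atoms of `{lo,lo+K;γ}`), `pseudoSib_lawOK`, `pseudoSib_mean`;
* **`sdec_cons_of_okPieces`** — GIVEN `hGPS`: `L` law-OK affordable siblings with `SDEC x (ftop L) (flaw L)`, `s` law-OK + affordable whose `ρ` is a finite
  same-mean mixture of pieces `{loᵢ, loᵢ+Kᵢ; γᵢ}` (tops `≤ s.M`) each of which is light, or a blob, or floored, or has its block on the floor
  (`1 ≤ loᵢ`, `1 ≤ Kᵢ`, `x ≤ s.q·γᵢ`) ⟹ `SDEC x (ftop (s :: L)) (flaw (s :: L))`.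

HONEST STATUS.  Conditional; GLUED-PIECE SLICE, `SiblingStep` / `GateStepN` / `LightResidDECOracle` / `FarTreeRow` OPEN; RATE class (log\*) / honest sentence of
`run/shared/lean/prim/quant/README.md` unchanged.  [this work].  Nothing here is cited as a published result.  The gluing rows served
[cite: KozmaNitzan2024, Conjecture 3 (p. 15)]; product measure [cite: Grimmett1999, §1.3 p. 10].
-/

noncomputable section

open scoped BigOperators

namespace Summit.CriticalPhenomena.PercolationContinuityZ3.Theorems
namespace Quant

open Finset

/-- the two-point law `{lo, hi; g}` (as in `…QuantLawDEC`) -/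
local notation3 "TP[" lo ", " hi ", " g ", " h "]" =>
  (g : ℝ) * (if (h : ℕ) = (hi : ℕ) then (1 : ℝ) else 0) + (1 - (g : ℝ)) * (if (h : ℕ) = (lo : ℕ) then (1 : ℝ) else 0)

namespace LawDec

/-- the point mass `δ_K` -/
local notation3 "δ[" K "]" => (fun k : ℕ => if k = (K : ℕ) then (1 : ℝ) else 0)

/-- the two-point law `{lo, lo+K; g}` = `lo` sure relays and a blob of size `K` at gate `g` -/
local notation3 "TPL[" lo ", " K ", " g "]" => lconv lo K δ[lo] (gate δ[K] g)

/-- the piece `{lo, lo+K; g}` as a pseudo-sibling under the gate `q` -/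
local notation3 "PS[" q ", " lo ", " K ", " g "]" => (⟨q, 0, 0, lo + K, TPL[lo, K, g]⟩ : Sib)

/-! ### Pseudo-siblings -/

/-- the charged atoms of `{lo, lo+K; γ}` are `lo` and `lo + K`. [this work] -/
theorem tpl_charged (lo K : ℕ) (g : ℝ) (h : ℕ) (hh : (TPL[lo, K, g]) h ≠ 0) : h = lo ∨ h = lo + K := by
  rw [tpLaw_apply] at hh
  by_contra hc
  rw [not_or] at hc
  rw [if_neg hc.2, if_neg hc.1] at hh
  exact hh (by ring)

/-- the pseudo-sibling `⟨q, _, _, lo+K, {lo,lo+K;γ}⟩` is law-OK for `0 < q < 1`, `0 ≤ γ ≤ 1`. [this work] -/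
theorem pseudoSib_lawOK (q g : ℝ) (lo K : ℕ) (hq0 : 0 < q) (hq1 : q < 1) (hg0 : 0 ≤ g) (hg1 : g ≤ 1) : (PS[q, lo, K, g]).LawOK := by
  obtain ⟨p0, pM, p1, _, _⟩ := hs_facts lo K g hg0 hg1
  exact ⟨hq0, hq1, p0, pM, p1⟩

/-- its sub-forest mean is `lo + K·γ`. [this work] -/
theorem pseudoSib_mean (q g : ℝ) (lo K : ℕ) (hg0 : 0 ≤ g) (hg1 : g ≤ 1) : (PS[q, lo, K, g]).mean = lo + K * g :=
  (hs_facts lo K g hg0 hg1).2.2.2.1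

/-! ### The reduction -/

/-- **A SIBLING WITH OK PIECES IS ADJOINABLE, GIVEN THE GLUED-PIECE SLICE.**  See the file header.  `hGPS` is the glued-piece slice at the floor `x` (any first factor);
the decomposition datum of `s.ρ` is a finite same-mean mixture of pieces `{loᵢ, loᵢ+Kᵢ; γᵢ}`; `hOK` says every piece is light (`Kγ ≤ lo`), a blob (`lo = 0`),
floored (`x·K ≤ q(lo + Kγ) − lo`), or glued with its block on the floor (`1 ≤ lo`, `1 ≤ K`, `x ≤ q·γ`). [this work] -/
theorem sdec_cons_of_okPieces {x : ℝ} (hx0 : 0 < x) (hx1 : x < 1)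
    (hGPS : ∀ (B' : ℕ) (β' : ℕ → ℝ) (r k : ℕ) (q g : ℝ), (∀ h, 0 ≤ β' h) → (∀ h, B' < h → β' h = 0) →
      ∑ h ∈ Finset.range (B' + 1), β' h = 1 → x * (B' : ℝ) ≤ ∑ h ∈ Finset.range (B' + 1), (h : ℝ) * β' h → SDEC x B' β' →
      0 < q → q < 1 → 0 ≤ g → g ≤ 1 → 1 ≤ r → 1 ≤ k → x ≤ q * g → x * ((r : ℝ) + k) ≤ q * ((r : ℝ) + k * g) →
      SDEC x (B' + (r + k)) (lconv B' (r + k) β' (gate (TPL[r, k, g]) q)))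
    (L : List Sib) (s : Sib) (hL : ∀ t ∈ L, t.LawOK) (hxL : ∀ t ∈ L, x * (t.M : ℝ) ≤ t.q * t.mean) (hS : SDEC x (ftop L) (flaw L))
    (hs : s.LawOK) (hxs : x * (s.M : ℝ) ≤ s.q * s.mean)
    {ι : Type} [Fintype ι] (w : ι → ℝ) (lo K : ι → ℕ) (γ : ι → ℝ)
    (hw0 : ∀ i, 0 ≤ w i) (hw1 : ∑ i, w i = 1) (hγ : ∀ i, 0 ≤ γ i ∧ γ i ≤ 1) (htop : ∀ i, lo i + K i ≤ s.M)
    (hmean : ∀ i, (lo i : ℝ) + K i * γ i = s.mean) (hmix : ∀ h, s.ρ h = ∑ i, w i * (TPL[lo i, K i, γ i]) h)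
    (hOK : ∀ i, (K i : ℝ) * γ i ≤ lo i ∨ lo i = 0 ∨ x * (K i : ℝ) ≤ s.q * ((lo i : ℝ) + K i * γ i) - lo i ∨
      (1 ≤ lo i ∧ 1 ≤ K i ∧ x ≤ s.q * γ i)) :
    SDEC x (ftop (s :: L)) (flaw (s :: L)) := by
  classical
  obtain ⟨hq0, hq1, ρ0, ρM, ρ1⟩ := hs
  obtain ⟨f0, fM, f1, fmn⟩ := flaw_facts L hL
  have hta : x * (ftop L : ℝ) ≤ ∑ h ∈ Finset.range (ftop L + 1), (h : ℝ) * flaw L h := by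
    rw [fmn]; exact floor_ftop_le_fmean' x L hxL
  obtain ⟨_, _, _, smn⟩ := flaw_facts (s :: L) (fun t ht => by
    rcases List.mem_cons.1 ht with rfl | ht
    · exact ⟨hq0, hq1, ρ0, ρM, ρ1⟩
    · exact hL t ht)
  -- the pseudo-siblings and their forest laws
  have hPS : ∀ i, (PS[s.q, lo i, K i, γ i]).LawOK := fun i => pseudoSib_lawOK s.q (γ i) (lo i) (K i) hq0 hq1 (hγ i).1 (hγ i).2
  have hLi : ∀ i, ∀ t ∈ PS[s.q, lo i, K i, γ i] :: L, t.LawOK := fun i t ht => by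
    rcases List.mem_cons.1 ht with rfl | ht
    · exact hPS i
    · exact hL t ht
  have Ci := fun i => flaw_facts (PS[s.q, lo i, K i, γ i] :: L) (hLi i)
  have hmean_i : ∀ i, fmean (PS[s.q, lo i, K i, γ i] :: L) = fmean (s :: L) := by
    intro i
    simp only [fmean]
    rw [pseudoSib_mean s.q (γ i) (lo i) (K i) (hγ i).1 (hγ i).2, hmean i]
  have h2 : ∀ i, x * ((lo i + K i : ℕ) : ℝ) ≤ s.q * s.mean := fun i =>
    le_trans (mul_le_mul_of_nonneg_left (by exact_mod_cast htop i) hx0.le) hxs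
  have hxs_i : ∀ i, x * (((PS[s.q, lo i, K i, γ i]).M : ℕ) : ℝ) ≤ (PS[s.q, lo i, K i, γ i]).q * (PS[s.q, lo i, K i, γ i]).mean := by
    intro i
    rw [pseudoSib_mean s.q (γ i) (lo i) (K i) (hγ i).1 (hγ i).2, hmean i]
    exact h2 i
  -- elementary bounds on a piece
  have hm0 : ∀ i, 0 ≤ (lo i : ℝ) + K i * γ i := fun i =>
    add_nonneg (Nat.cast_nonneg _) (mul_nonneg (Nat.cast_nonneg _) (hγ i).1)
  have hq' : ∀ i, s.q * ((lo i : ℝ) + K i * γ i) ≤ (lo i : ℝ) + K i * γ i := fun i => mul_le_of_le_one_left (hm0 i) hq1.le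
  have hKγ1 : ∀ i, (K i : ℝ) * γ i ≤ K i := fun i => mul_le_of_le_one_right (Nat.cast_nonneg _) (hγ i).2
  -- each component is SDEC
  have hSi : ∀ i, SDEC x (ftop (PS[s.q, lo i, K i, γ i] :: L)) (flaw (PS[s.q, lo i, K i, γ i] :: L)) := by
    intro i
    have hlo0 : (0 : ℝ) ≤ lo i := Nat.cast_nonneg _
    rcases hOK i with hlight | hzero | hfloor | ⟨hlo1, hK1, hfl⟩
    · -- light piece: a tame pseudo-sibling
      refine sdec_cons_of_tame hx0 hx1 L _ hL hxL hS (hPS i) (hxs_i i) (fun h hh hch => Or.inl ?_)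
      rw [pseudoSib_mean s.q (γ i) (lo i) (K i) (hγ i).1 (hγ i).2]
      rcases tpl_charged (lo i) (K i) (γ i) h hch with rfl | rfl
      · linarith [hq' i]
      · push_cast; linarith [hq' i, hKγ1 i]
    · -- blob piece (`lo = 0`): a tame pseudo-sibling (its only positive count is `K`)
      refine sdec_cons_of_tame hx0 hx1 L _ hL hxL hS (hPS i) (hxs_i i) (fun h hh hch => Or.inl ?_)
      rw [pseudoSib_mean s.q (γ i) (lo i) (K i) (hγ i).1 (hγ i).2]
      rcases tpl_charged (lo i) (K i) (γ i) h hch with h1 | h1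
      · exfalso; omega
      · rw [h1]; push_cast; linarith [hq' i, hKγ1 i]
    · -- floored piece: a tame pseudo-sibling (count `lo` floored, count `lo+K` light)
      refine sdec_cons_of_tame hx0 hx1 L _ hL hxL hS (hPS i) (hxs_i i) (fun h hh hch => ?_)
      rw [pseudoSib_mean s.q (γ i) (lo i) (K i) (hγ i).1 (hγ i).2]
      rcases tpl_charged (lo i) (K i) (γ i) h hch with rfl | rfl
      · right
        push_cast
        have e : x * (((lo i : ℝ) + K i) - lo i) = x * (K i : ℝ) := by ring
        rw [e]; exact hfloor
      · left; push_cast; linarith [hq' i, hKγ1 i]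
    · -- glued piece with its block on the floor: the GLUED-PIECE SLICE
      have haff : x * ((lo i : ℝ) + K i) ≤ s.q * ((lo i : ℝ) + K i * γ i) := by
        have := h2 i
        rw [← hmean i] at this
        push_cast at this
        exact this
      exact hGPS (ftop L) (flaw L) (lo i) (K i) s.q (γ i) f0 fM f1 hta hS hq0 hq1 (hγ i).1 (hγ i).2 hlo1 hK1 hfl haff
  -- assemble the same-mean mixture
  show SDEC x (ftop L + s.M) (lconv (ftop L) s.M (flaw L) (gate s.ρ s.q))
  refine sdec_of_gatedSDECMixture x (ftop L + s.M) _ w (fun _ => 1) (fun i => ftop L + (lo i + K i))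
    (fun i => flaw (PS[s.q, lo i, K i, γ i] :: L)) hx0 hw0 hw1 (fun _ => ⟨hx1, le_rfl⟩)
    (fun i => (Ci i).1) (fun i => (Ci i).2.1) (fun i => (Ci i).2.2.1) (fun i => ?_) (fun i => by rw [div_one]; exact hSi i)
    (fun i => Nat.add_le_add_left (htop i) (ftop L)) (fun i => ?_) (fun k => ?_)
  · -- affordability of the component
    have cmn := (Ci i).2.2.2
    simp only [ftop] at cmn
    rw [div_one, cmn, hmean_i i]
    simp only [fmean]
    have e : (((ftop L + (lo i + K i) : ℕ) : ℝ)) = (ftop L : ℝ) + ((lo i + K i : ℕ) : ℝ) := by push_cast; ring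
    rw [e, mul_add]
    have h1 : x * (ftop L : ℝ) ≤ fmean L := by rw [← fmn]; exact hta
    exact add_le_add h1 (h2 i)
  · -- the common mean `fmean (s :: L)`
    have cmn := (Ci i).2.2.2
    simp only [ftop] at cmn
    simp only [ftop, flaw] at smn
    rw [one_mul, cmn, hmean_i i, ← smn]
  · -- the mixture identity: the gate is affine, `lconv` is linear, tops by vanishing
    simp_rw [gate_one]
    have eg : ∀ h, gate s.ρ s.q h = ∑ i, w i * gate (TPL[lo i, K i, γ i]) s.q h :=
      gate_mixture w (fun i => TPL[lo i, K i, γ i]) s.q hw1 s.ρ hmix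
    rw [show gate s.ρ s.q = fun h => ∑ i, w i * gate (TPL[lo i, K i, γ i]) s.q h from funext eg, lconv_sum_right]
    refine Finset.sum_congr rfl fun i _ => ?_
    obtain ⟨p0, pM, p1, _, _⟩ := hs_facts (lo i) (K i) (γ i) (hγ i).1 (hγ i).2
    obtain ⟨_, gM, _⟩ := gate_laws (lo i + K i) (TPL[lo i, K i, γ i]) s.q hq0.le hq1.le p0 pM p1
    show w i * lconv (ftop L) s.M (flaw L) (gate (TPL[lo i, K i, γ i]) s.q) k
      = w i * lconv (ftop L) (lo i + K i) (flaw L) (gate (TPL[lo i, K i, γ i]) s.q) k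
    rw [lconv_top_right_of_le (ftop L) (lo i + K i) s.M (flaw L) _ (htop i) gM k]

end LawDec
end Quant
end Summit.CriticalPhenomena.PercolationContinuityZ3.Theorems
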